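import Summits.QuantumFields.BalabanUV.T4Continuum.Support.ActivityStepJunction
import Summits.QuantumFields.BalabanUV.T4Continuum.Support.OutputRateTowerInstance

/-!
# NE5 ∕ U3, route P2 (activity-Lipschitz ∕ Kotecký–Preiss): the route's END with W4 PRODUCED and W1 FED FROM ROW NE2's
# PERTURBED-TOWER INSTANCE — skeleton row A1 of `t4/skeletons/NE5-t4-ne5-p2.md`

Cell `pub-balaban`, unit `b2b-balaban-t4-ne5-p2-g17` (T⁴ fan-out NE5 ∕ node U3, PROVER seat P2 «polymer-activity Lipschitz route»,
ROUND-2 skeleton `t4/skeletons/NE5-t4-ne5-p2.md` §6 row A1).  Summits-side new work under the LEAN PLACEMENT RULE (cell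
mathematics — bookkeeping over landed leaves; NOT a Literature module).  HONEST FRAMING: rung (B)+1 of the FINITE-VOLUME T⁴
continuum programme — NOT infinite volume, NOT a mass gap, NOT the Clay problem, and NOT a proof of NE5: the cell's spine estimate
NE5 (η-rate of the one-step outputs as functionals of V) is NOT PRINTED in [Balaban1987RG1]–[Balaban1989LargeFieldII] (they print
ε-UNIFORM bounds — [Balaban1988RG2Cluster] (2.38)–(2.41) — never η-RATES) and is NOT proved here.  HONEST DEPENDENCY (cell line,
verbatim): continuum YM on T⁴ ⇐ BetaPertH ∧ nine spine estimates (0/9 proved); BetaPertH ⇐ (D1) ∧ (D4) ∧ CAP+tail; G-an2-4 gates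
asym, D1 and NE2/3/4.

WHAT THIS FILE DOES (composition only; every input BY NAME).  The activity route's END face
`ActivityStepJunction.TermFamily.ne5_above_max_of_model_reach_step` (the term model `TermFamily.model` READING the row owner's
step model `N : StepModel C Op Hist`; walls in the row owner's names W1 `N.OperatorRate`, W3 `N.InsScaleBound`, W4
`N.InsertionRate`) is re-emitted with
* **W4 PRODUCED** (§1): `N.InsertionRate` is no longer a binder — it is the row owner's theorem
  `OutputRateInsertion.insertionRate_of_operatorRate` (W1 ∧ `ReadsIns` ∧ `InsOpEnvelope` ∧ `InsBoundA` ∧ reach, under the same-data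
  reading `InsOpModel.ofStep N Ins`: the insertion operators ARE the step's operator data), so the ONLY two-spacing rate binder left
  is W1;
* **W1 FED FROM ROW NE2's PERTURBED-TOWER INSTANCE** (§2): `N.OperatorRate W (cR·Cpert(t)∕r₀) θ` is the row owner's theorem
  `OutputRateTowerInstance.operatorRate_of_perturbed_floor` from row NE2's `FreeTowerLaws` (U = 1 tower inputs with geometric
  defects; a THEOREM for Bałaban's `Δ_a` with King's pairing, `NE2PerturbedLayer.freeTowerLaws_king`) ∧ the per-background-index
  `BackgroundResolventTower.PerturbationLaws D (P j) Jinj κP (e₂ j)` (row NE2's typed U ≠ 1 inequalities (H-bd)∕(H-cons), NOT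
  PRINTED for Bałaban's `Δ_a(U) − Δ_a`) ∧ `‖t‖κP < 1` ∧ the READING `ReadsTower` ∧ an [I]-type margin floor — so on the
  tower-readable operator species the route carries NO η-rate LAW binder at all;
* **the minimiser split** (§3): W1 := [row NE2's perturbed tower law read on the pair (run A, `opMid`)] + [background-Lipschitz ×
  row NE3's `T4EtaRateMin.LocalRate`] (`OutputRateTowerSocket.operatorRate_of_towerLaw_split`), W4 produced from the same W1.
The conclusion of every face is LITERALLY `∃ C₅, T4OutputRate.NE5 EA EB W κ θ′ C₅` for every `θ′ > max θ r_fb`,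
`r_fb = ω + A·Λhist·c∕(s − Λhist·ρ₀′)` (the activity route's decided threshold, `T4ActivityThreshold`).

STATUS OF EVERY HYPOTHESIS (skeleton §3 leaf ids).  NOT PRINTED, displayed: L01 `ClusterRep.Represents`, L02 `InputModel.Realizes`
(MI-R), the readings `ReadsStep`∕`ReadsIns`∕`ReadsTower(Mid)`, row NE2's `PerturbationLaws` per background index (L10's residual),
row NE3's `LocalRate` (§3), W2-ins `InsOpEnvelope` + `InsBoundA`, W3 `InsScaleBound` (L12 level), the numeric census L13 ((R1)–(R3),
the insertion reach `δθ^{k₁} ≤ ρ₁ < 1`, the rate clause).  PRINTED KIND for one run: `WellFormed` (L04∕L05), `InBase` (L06), `KPInflated`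
+ `Σ G ≤ m` (L03), `DecayExtract`∕`PinBudget` (L08), `DecayBound` ×2 (L09 — [Balaban1987RG1] (0.25) p. 257 ∕ (1.18) p. 263 as LOCATORS on
hypothesis shapes, never asserted), `InsAffine`∕`InsBlind`∕`InsHomog` (L12 structure, [Balaban1988RG2Cluster] (1.33) p. 9).  PROVED and
consumed by name: the activity modulus `ActivityLipschitz₂` of the term model (`ActivityTermModel.activityLipschitz₂_model`), the
pinned activity pencil (`T4ActivityLipschitz`), [KP86] (`ClusterExpansionKPBound.touchSum_le_of_kp`), the threshold recursion, row
NE2's `oneStepAveragedLaw_perturbed`.  ABSOLUTE RULE respected: no cell-minted statement is cited as a fact; the manuscripts under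
audit are cited for KIND∕locus only.  0 sorry; no new axioms.  Record `t4/T4-EST-U3-NE5-P2.md`; skeleton `t4/skeletons/NE5-t4-ne5-p2.md`.
-/

noncomputable section

open Set Metric MeasureTheory
open scoped Matrix Matrix.Norms.L2Operator BigOperators

namespace Summit.QuantumFields.BalabanUV.T4Continuum.ActivityRouteEnd

open Literature.MathematicalPhysics.QuantumFieldTheory.Balaban1983to89
open Literature.MathematicalPhysics.QuantumFieldTheory.Balaban1983to89.T4OutputRate (Carriers Functional DecayBound NE5)
open Literature.MathematicalPhysics.QuantumFieldTheory.Balaban1983to89.T4ActivityLipschitz (ClusterRep)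
open Literature.MathematicalPhysics.QuantumFieldTheory.Balaban1983to89.T4ActivityRecursion (InputModel KPInflated)
open Literature.MathematicalPhysics.QuantumFieldTheory.Balaban1983to89.T4InputCauchyRateData (StepModel)
open Literature.MathematicalPhysics.QuantumFieldTheory.Balaban1983to89.T4EtaRateMin (Readings LocalRate)
open Summit.QuantumFields.BalabanUV.T4Continuum.CovariantAveragingTower
open Summit.QuantumFields.BalabanUV.T4Continuum.BackgroundResolventTower
open Summit.QuantumFields.BalabanUV.T4Continuum.OutputRateInsertion
open Summit.QuantumFields.BalabanUV.T4Continuum.OutputRateTowerSocket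
open Summit.QuantumFields.BalabanUV.T4Continuum.OutputRateTowerInstance
open Summit.QuantumFields.BalabanUV.T4Continuum.ActivityTermModel (TermFamily)
open Summit.QuantumFields.BalabanUV.T4Continuum.ActivityStepJunction (ReadsStep)

variable {C : Carriers} {R : ClusterRep C} {Op Hist : Type*} [NormedAddCommGroup Op] [NormedSpace ℂ Op]
  [NormedAddCommGroup Hist] [NormedSpace ℂ Hist] [CompleteSpace Hist]
variable {ι κ S Ω Ω₀ 𝒴 𝒞 : Type*} [Fintype ι] [Fintype κ] [MeasurableSpace Ω] [MeasurableSpace Ω₀] {J : Type*}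
  [DecidableEq ι] [DecidableEq κ] [DecidableEq 𝒞] (𝔉 : TermFamily R Op Hist ι κ S Ω Ω₀ 𝒴 𝒞 J)

/-! ## §1 The activity route's END with W4 PRODUCED from W1 (the only two-spacing rate binder left is `N.OperatorRate`) -/

/-- [folklore] The produced insertion-rate constant `δ′ = Gi·δ∕(1 − ρ₁) + 2Gi∕θ^{k₁}` is non-negative. -/
theorem deltaIns_nonneg {Gi δ ρ₁ θ : ℝ} {k₁ : ℕ} (hGi : 0 ≤ Gi) (hδ : 0 ≤ δ) (hρ₁ : ρ₁ < 1) (hθ0 : 0 < θ) :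
    0 ≤ Gi * δ / (1 - ρ₁) + 2 * Gi / θ ^ k₁ :=
  add_nonneg (div_nonneg (mul_nonneg hGi hδ) (sub_pos.2 hρ₁).le)
    (div_nonneg (mul_nonneg zero_le_two hGi) (pow_pos hθ0 k₁).le)

/-- [folklore] **END-T WITH W4 PRODUCED.**  For a term model READING the step model `N` (`ReadsStep`), with the insertion maps
read as ONE functional of the step's operator data (`InsOpModel.ofStep N Ins`: `ReadsIns`, `InsOpEnvelope κ E₀ Gi`, `InsBoundA`)
and the insertion reach `δθ^{k₁} ≤ ρ₁ < 1`, the activity route closes NE5 at every rate `θ′ > max θ r_fb` with W1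
`N.OperatorRate W δ θ` as its ONLY binder of two-spacing-rate type (W4 is `OutputRateInsertion.insertionRate_of_operatorRate`,
δ′ = `Gi·δ∕(1 − ρ₁) + 2Gi∕θ^{k₁}`).  Every other input BY NAME and unchanged (header; skeleton leaves L01–L13). -/
theorem ne5_above_max_of_model_reach_readsIns {N : StepModel C Op Hist} (Ins : ℕ → Op → (C.Dom → ℝ) → Hist)
    (hN : ReadsStep 𝔉.model N) {EA : Functional C C.BgA} {EB : Functional C C.BgB} {W : Set (ℕ → ℝ)}
    {m : (ℕ → ℝ) → C.BgB → R.P → ℝ} {a d : R.P → ℝ} {δX : C.Dom → ℝ}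
    {A A₀ E₀ E₁ Gi κ θ δ ρ₁ c ω s Λop Λhist ρ₀ ρ₀' : ℝ} {k₁ : ℕ}
    (hwf : 𝔉.WellFormed W)
    (hsum : ∀ g ∈ W, ∀ (U : C.BgB) (X : C.Dom), ∀ γ ∈ R.vol X, ∑ i ∈ 𝔉.terms g U X γ, 𝔉.G Λop Λhist ρ₀ g U X γ i ≤ m g U γ)
    (hρ01 : ρ₀ ≤ 1)
    (hrep : R.Represents EA EB) (hreal : 𝔉.model.Realizes EA EB W) (hbase : 𝔉.model.InBase EB W)
    (hKP : KPInflated R W m s a d) (hdec : R.DecayExtract δX d) (hpin : R.PinBudget a δX A κ)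
    (hdA : DecayBound EA W A₀ κ) (hdB : DecayBound EB W E₀ κ)
    (hop : N.OperatorRate W δ θ)
    (hreadI : (InsOpModel.ofStep N Ins).ReadsIns W) (hienv : (InsOpModel.ofStep N Ins).InsOpEnvelope W κ E₀ Gi)
    (hbdA : (InsOpModel.ofStep N Ins).InsBoundA W κ E₀ Gi) (hGi : 0 ≤ Gi) (hρ₁ : ρ₁ < 1) (hreachI : δ * θ ^ k₁ ≤ ρ₁)
    (haff : N.InsAffine W) (hblind : N.InsBlind W) (hhom : N.InsHomog W) (hunit : N.InsScaleBound W κ E₁ c ω)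
    (hE₁ : 0 < E₁) (hA : 0 ≤ A) (hΛop : 0 < Λop) (hΛhist : 0 < Λhist) (hρ : max (Λhist / Λop) 1 * ρ₀' ≤ ρ₀)
    (hs : Λhist * ρ₀' < s) (hδ : 0 ≤ δ) (hθ0 : 0 < θ) (hθ1 : θ < 1)
    (hc : 0 ≤ c) (hω : 0 < ω) (hω1 : ω < 1) (hreach : c * (A₀ + E₀) / (1 - ω) < ρ₀')
    {θ' : ℝ} (hθ' : max θ (ω + A * Λhist / (s - Λhist * ρ₀') * c) < θ') :
    ∃ C₅, NE5 EA EB W κ θ' C₅ :=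
  ActivityStepJunction.TermFamily.ne5_above_max_of_model_reach_step 𝔉 hN hwf hsum hρ01 hrep hreal hbase hKP hdec hpin hdA hdB
    hop (insertionRate_of_operatorRate N Ins hreadI hienv hbdA hop hδ hθ0 hθ1.le hρ₁ hreachI) haff hblind hhom hunit hE₁ hA
    hΛop hΛhist hρ hs hδ (deltaIns_nonneg hGi hδ hρ₁ hθ0) hθ0.le hθ1 hc hω hω1 hreach hθ'

/-- [folklore] **… and AT the threshold `max θ r_fb` off resonance**, W4 produced likewise. -/
theorem ne5_at_max_of_model_reach_readsIns {N : StepModel C Op Hist} (Ins : ℕ → Op → (C.Dom → ℝ) → Hist)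
    (hN : ReadsStep 𝔉.model N) {EA : Functional C C.BgA} {EB : Functional C C.BgB} {W : Set (ℕ → ℝ)}
    {m : (ℕ → ℝ) → C.BgB → R.P → ℝ} {a d : R.P → ℝ} {δX : C.Dom → ℝ}
    {A A₀ E₀ E₁ Gi κ θ δ ρ₁ c ω s Λop Λhist ρ₀ ρ₀' : ℝ} {k₁ : ℕ}
    (hwf : 𝔉.WellFormed W)
    (hsum : ∀ g ∈ W, ∀ (U : C.BgB) (X : C.Dom), ∀ γ ∈ R.vol X, ∑ i ∈ 𝔉.terms g U X γ, 𝔉.G Λop Λhist ρ₀ g U X γ i ≤ m g U γ)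
    (hρ01 : ρ₀ ≤ 1)
    (hrep : R.Represents EA EB) (hreal : 𝔉.model.Realizes EA EB W) (hbase : 𝔉.model.InBase EB W)
    (hKP : KPInflated R W m s a d) (hdec : R.DecayExtract δX d) (hpin : R.PinBudget a δX A κ)
    (hdA : DecayBound EA W A₀ κ) (hdB : DecayBound EB W E₀ κ)
    (hop : N.OperatorRate W δ θ)
    (hreadI : (InsOpModel.ofStep N Ins).ReadsIns W) (hienv : (InsOpModel.ofStep N Ins).InsOpEnvelope W κ E₀ Gi)
    (hbdA : (InsOpModel.ofStep N Ins).InsBoundA W κ E₀ Gi) (hGi : 0 ≤ Gi) (hρ₁ : ρ₁ < 1) (hreachI : δ * θ ^ k₁ ≤ ρ₁)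
    (haff : N.InsAffine W) (hblind : N.InsBlind W) (hhom : N.InsHomog W) (hunit : N.InsScaleBound W κ E₁ c ω)
    (hE₁ : 0 < E₁) (hA : 0 ≤ A) (hΛop : 0 < Λop) (hΛhist : 0 < Λhist) (hρ : max (Λhist / Λop) 1 * ρ₀' ≤ ρ₀)
    (hs : Λhist * ρ₀' < s) (hδ : 0 ≤ δ) (hθ0 : 0 < θ) (hθ1 : θ < 1)
    (hc : 0 ≤ c) (hω : 0 < ω) (hω1 : ω < 1) (hreach : c * (A₀ + E₀) / (1 - ω) < ρ₀')
    (hres : θ ≠ ω + A * Λhist / (s - Λhist * ρ₀') * c) :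
    ∃ C₅, NE5 EA EB W κ (max θ (ω + A * Λhist / (s - Λhist * ρ₀') * c)) C₅ :=
  ActivityStepJunction.TermFamily.ne5_at_max_of_model_reach_step 𝔉 hN hwf hsum hρ01 hrep hreal hbase hKP hdec hpin hdA hdB
    hop (insertionRate_of_operatorRate N Ins hreadI hienv hbdA hop hδ hθ0 hθ1.le hρ₁ hreachI) haff hblind hhom hunit hE₁ hA
    hΛop hΛhist hρ hs hδ (deltaIns_nonneg hGi hδ hρ₁ hθ0) hθ0.le hθ1 hc hω hω1 hreach hres

/-! ## §2 W1 := row NE2's perturbed-tower instance (`operatorRate_of_perturbed_floor`), W4 produced: NO η-rate LAW binder left on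
## the tower-readable operator species — displayed instead: `FreeTowerLaws` (U = 1), per-index `PerturbationLaws`, the defect constants,
## the coupling, the reading `ReadsTower`, the margin floor -/

section Perturbed

variable {ιT : ℕ → Type*} [∀ k, Fintype (ιT k)] [∀ k, DecidableEq (ιT k)]
variable {Jx : Type*} {D : (k : ℕ) → Matrix (ιT k) (ιT k) ℂ} {Av : (k : ℕ) → Matrix (ιT k) (ιT (k + 1)) ℂ}
  {Jinj : (k : ℕ) → Matrix (ιT (k + 1)) (ιT k) ℂ} {F : (k : ℕ) → Matrix (ιT k) (ιT k) ℂ} {r κP : ℝ} {e₀ e₁ f : ℕ → ℝ}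
  {e₂ : Jx → ℕ → ℝ} {P : Jx → (k : ℕ) → Matrix (ιT k) (ιT k) ℂ} {C₀ C₁ C₂ Cf : ℝ} {t : ℂ}

/-- [folklore] W1's constant from the perturbed towers is non-negative. -/
theorem deltaOp_nonneg {cR r₀ : ℝ} (ht : ‖t‖ * κP < 1) (hC₀ : 0 ≤ C₀) (hC₁ : 0 ≤ C₁) (hC₂ : 0 ≤ C₂) (hCf : 0 ≤ Cf)
    (hcR : 0 ≤ cR) (hr₀ : 0 < r₀) : 0 ≤ cR * Cpert κP C₀ C₁ C₂ Cf t / r₀ :=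
  div_nonneg (mul_nonneg hcR (Cpert_nonneg ht hC₀ hC₁ hC₂ hCf)) hr₀.le

/-- [folklore] **THE ACTIVITY ROUTE's END WITH NO η-RATE LAW BINDER ON THE TOWER-READABLE OPERATOR SPECIES.**  W1 := the row
owner's `operatorRate_of_perturbed_floor` (inputs displayed: `hfree` = row NE2's `FreeTowerLaws` — U = 1, a theorem for Bałaban's
`Δ_a` and King's pairing in row NE2's files; `hpert` = PER BACKGROUND INDEX row NE2's typed U ≠ 1 inequalities `PerturbationLaws`,
NOT IN PRINT for Bałaban's `Δ_a(U) − Δ_a`; the geometric defect constants `C₀ C₁ C₂ Cf` at the towers' rate `θ`; the coupling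
`‖t‖κP < 1`; the reading `hread`; the floor `r₀`), W4 PRODUCED (§1), then the term model's END.  `hδ : cR·Cpert(t)∕r₀ = δ`
abbreviates W1's constant. -/
theorem ne5_above_max_of_model_reach_perturbed {N : StepModel C Op Hist} (Ins : ℕ → Op → (C.Dom → ℝ) → Hist)
    (hN : ReadsStep 𝔉.model N) {EA : Functional C C.BgA} {EB : Functional C C.BgB} {W : Set (ℕ → ℝ)}
    {m : (ℕ → ℝ) → C.BgB → R.P → ℝ} {a d : R.P → ℝ} {δX : C.Dom → ℝ} {tow : ℕ → (ℕ → ℝ) → C.BgB → Jx}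
    {A A₀ E₀ E₁ Gi κ θ cR r₀ δ ρ₁ c ω s Λop Λhist ρ₀ ρ₀' : ℝ} {k₁ : ℕ}
    -- row NE2's inputs (W1's producer) and the reading
    (hr : 0 < r) (hfree : FreeTowerLaws D Av Jinj F r e₀ e₁ f) (hpert : ∀ j, PerturbationLaws D (P j) Jinj κP (e₂ j))
    (h₀ : ∀ k, e₀ k ≤ C₀ * θ ^ k) (h₁ : ∀ k, e₁ k ≤ C₁ * θ ^ k) (h₂ : ∀ j k, e₂ j k ≤ C₂ * θ ^ k)
    (hf : ∀ k, f k ≤ Cf * θ ^ k) (hC₀ : 0 ≤ C₀) (hC₁ : 0 ≤ C₁) (hC₂ : 0 ≤ C₂) (hCf : 0 ≤ Cf) (ht : ‖t‖ * κP < 1)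
    (hread : ReadsTower N (fun _ : Jx => Av) (pertTower D P t) r W cR tow) (hcR : 0 ≤ cR) (hfl : ∀ k, r₀ ≤ N.rOp k)
    (hr₀ : 0 < r₀) (hδ : cR * Cpert κP C₀ C₁ C₂ Cf t / r₀ = δ)
    -- the term model and the one-run ∕ structural leaves
    (hwf : 𝔉.WellFormed W)
    (hsum : ∀ g ∈ W, ∀ (U : C.BgB) (X : C.Dom), ∀ γ ∈ R.vol X, ∑ i ∈ 𝔉.terms g U X γ, 𝔉.G Λop Λhist ρ₀ g U X γ i ≤ m g U γ)
    (hρ01 : ρ₀ ≤ 1)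
    (hrep : R.Represents EA EB) (hreal : 𝔉.model.Realizes EA EB W) (hbase : 𝔉.model.InBase EB W)
    (hKP : KPInflated R W m s a d) (hdec : R.DecayExtract δX d) (hpin : R.PinBudget a δX A κ)
    (hdA : DecayBound EA W A₀ κ) (hdB : DecayBound EB W E₀ κ)
    (hreadI : (InsOpModel.ofStep N Ins).ReadsIns W) (hienv : (InsOpModel.ofStep N Ins).InsOpEnvelope W κ E₀ Gi)
    (hbdA : (InsOpModel.ofStep N Ins).InsBoundA W κ E₀ Gi) (hGi : 0 ≤ Gi) (hρ₁ : ρ₁ < 1) (hreachI : δ * θ ^ k₁ ≤ ρ₁)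
    (haff : N.InsAffine W) (hblind : N.InsBlind W) (hhom : N.InsHomog W) (hunit : N.InsScaleBound W κ E₁ c ω)
    (hE₁ : 0 < E₁) (hA : 0 ≤ A) (hΛop : 0 < Λop) (hΛhist : 0 < Λhist) (hρ : max (Λhist / Λop) 1 * ρ₀' ≤ ρ₀)
    (hs : Λhist * ρ₀' < s) (hθ0 : 0 < θ) (hθ1 : θ < 1)
    (hc : 0 ≤ c) (hω : 0 < ω) (hω1 : ω < 1) (hreach : c * (A₀ + E₀) / (1 - ω) < ρ₀')
    {θ' : ℝ} (hθ' : max θ (ω + A * Λhist / (s - Λhist * ρ₀') * c) < θ') :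
    ∃ C₅, NE5 EA EB W κ θ' C₅ := by
  have hδ0 : 0 ≤ δ := hδ ▸ deltaOp_nonneg ht hC₀ hC₁ hC₂ hCf hcR hr₀
  have hop : N.OperatorRate W δ θ :=
    hδ ▸ operatorRate_of_perturbed_floor N hr hfree hpert h₀ h₁ h₂ hf hC₀ hC₁ hC₂ hCf hθ0.le ht hread hcR hfl hr₀
  exact ne5_above_max_of_model_reach_readsIns 𝔉 Ins hN hwf hsum hρ01 hrep hreal hbase hKP hdec hpin hdA hdB hop hreadI hienv
    hbdA hGi hρ₁ hreachI haff hblind hhom hunit hE₁ hA hΛop hΛhist hρ hs hδ0 hθ0 hθ1 hc hω hω1 hreach hθ'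

/-! ## §3 The minimiser split: W1 := row NE2's perturbed tower law on the pair (run A, `opMid`) + background-Lipschitz × row NE3's
## `LocalRate` (`operatorRate_of_towerLaw_split`), W4 produced from the same W1 -/

/-- [folklore] **THE ACTIVITY ROUTE's END, MINIMISER SPLIT** — W1 = NE2 ∧ NE3 BOTH BY NAME: the first leg is row NE2's perturbed
tower law (rate `θ₂ ≤ θ`) read on the pair (run A, `opMid`) (`ReadsTowerMid`), the second leg = operator-Lipschitz in the background
(`hLip`, printed TYPE) × the minimiser distance dominated by ONE site-reading discrepancy of a `Readings` carrier with row NE3's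
`LocalRate Rd Cm θ` (`hR`, the one binder of rate type displayed besides `hpert`); W4 produced; `hδ : cR·Cpert(t)∕r₀ + Λb·Cm = δ`. -/
theorem ne5_above_max_of_model_reach_perturbed_split {N : StepModel C Op Hist} (Ins : ℕ → Op → (C.Dom → ℝ) → Hist)
    (hN : ReadsStep 𝔉.model N) {EA : Functional C C.BgA} {EB : Functional C C.BgB} {W : Set (ℕ → ℝ)}
    {m : (ℕ → ℝ) → C.BgB → R.P → ℝ} {a d : R.P → ℝ} {δX : C.Dom → ℝ} {tow : ℕ → (ℕ → ℝ) → C.BgB → Jx}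
    (opMid : (ℕ → ℝ) → C.BgB → ℕ → Op) (dist : ℕ → (ℕ → ℝ) → C.BgB → ℝ) {ιR XR : Type*} (Rd : Readings ιR XR)
    {A A₀ E₀ E₁ Gi κ θ₂ θ cR r₀ Λb Cm δ ρ₁ c ω s Λop Λhist ρ₀ ρ₀' : ℝ} {k₁ : ℕ}
    -- row NE2's inputs, the readings, the background-Lipschitz leg and row NE3's `LocalRate`
    (hr : 0 < r) (hfree : FreeTowerLaws D Av Jinj F r e₀ e₁ f) (hpert : ∀ j, PerturbationLaws D (P j) Jinj κP (e₂ j))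
    (h₀ : ∀ k, e₀ k ≤ C₀ * θ₂ ^ k) (h₁ : ∀ k, e₁ k ≤ C₁ * θ₂ ^ k) (h₂ : ∀ j k, e₂ j k ≤ C₂ * θ₂ ^ k)
    (hf : ∀ k, f k ≤ Cf * θ₂ ^ k) (hC₀ : 0 ≤ C₀) (hC₁ : 0 ≤ C₁) (hC₂ : 0 ≤ C₂) (hCf : 0 ≤ Cf) (ht : ‖t‖ * κP < 1)
    (hread : ReadsTowerMid N (fun _ : Jx => Av) (pertTower D P t) r W cR tow opMid) (hcR : 0 ≤ cR) (hθ₂ : 0 ≤ θ₂)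
    (hθ₂θ : θ₂ ≤ θ) (hfl : ∀ k, r₀ ≤ N.rOp k) (hr₀ : 0 < r₀)
    (hLip : ∀ k, ∀ g ∈ W, ∀ (U : C.BgB), ‖opMid g U k - N.opB g U k‖ ≤ Λb * dist k g U * N.rOp k) (hΛb : 0 ≤ Λb)
    (hR : LocalRate Rd Cm θ) (hCm : 0 ≤ Cm)
    (hdom : ∀ k, ∀ g ∈ W, ∀ (U : C.BgB), ∃ V ∈ Rd.dom, ∃ x : XR, dist k g U ≤ |Rd.loc (k + 1) V x - Rd.loc k V x|)
    (hδ : cR * Cpert κP C₀ C₁ C₂ Cf t / r₀ + Λb * Cm = δ)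
    -- the term model and the one-run ∕ structural leaves
    (hwf : 𝔉.WellFormed W)
    (hsum : ∀ g ∈ W, ∀ (U : C.BgB) (X : C.Dom), ∀ γ ∈ R.vol X, ∑ i ∈ 𝔉.terms g U X γ, 𝔉.G Λop Λhist ρ₀ g U X γ i ≤ m g U γ)
    (hρ01 : ρ₀ ≤ 1)
    (hrep : R.Represents EA EB) (hreal : 𝔉.model.Realizes EA EB W) (hbase : 𝔉.model.InBase EB W)
    (hKP : KPInflated R W m s a d) (hdec : R.DecayExtract δX d) (hpin : R.PinBudget a δX A κ)
    (hdA : DecayBound EA W A₀ κ) (hdB : DecayBound EB W E₀ κ)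
    (hreadI : (InsOpModel.ofStep N Ins).ReadsIns W) (hienv : (InsOpModel.ofStep N Ins).InsOpEnvelope W κ E₀ Gi)
    (hbdA : (InsOpModel.ofStep N Ins).InsBoundA W κ E₀ Gi) (hGi : 0 ≤ Gi) (hρ₁ : ρ₁ < 1) (hreachI : δ * θ ^ k₁ ≤ ρ₁)
    (haff : N.InsAffine W) (hblind : N.InsBlind W) (hhom : N.InsHomog W) (hunit : N.InsScaleBound W κ E₁ c ω)
    (hE₁ : 0 < E₁) (hA : 0 ≤ A) (hΛop : 0 < Λop) (hΛhist : 0 < Λhist) (hρ : max (Λhist / Λop) 1 * ρ₀' ≤ ρ₀)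
    (hs : Λhist * ρ₀' < s) (hθ0 : 0 < θ) (hθ1 : θ < 1)
    (hc : 0 ≤ c) (hω : 0 < ω) (hω1 : ω < 1) (hreach : c * (A₀ + E₀) / (1 - ω) < ρ₀')
    {θ' : ℝ} (hθ' : max θ (ω + A * Λhist / (s - Λhist * ρ₀') * c) < θ') :
    ∃ C₅, NE5 EA EB W κ θ' C₅ := by
  have hδ0 : 0 ≤ δ := hδ ▸ add_nonneg (deltaOp_nonneg ht hC₀ hC₁ hC₂ hCf hcR hr₀) (mul_nonneg hΛb hCm)
  have hop : N.OperatorRate W δ θ :=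
    hδ ▸ operatorRate_of_towerLaw_split N opMid dist Rd hr (towerContracting_perturbed hfree)
      (towerLaw_perturbed hr hfree hpert h₀ h₁ h₂ hf ht) hread hcR (Cpert_nonneg ht hC₀ hC₁ hC₂ hCf) hθ₂ hθ₂θ hfl hr₀ hLip
      hΛb hR hdom
  exact ne5_above_max_of_model_reach_readsIns 𝔉 Ins hN hwf hsum hρ01 hrep hreal hbase hKP hdec hpin hdA hdB hop hreadI hienv
    hbdA hGi hρ₁ hreachI haff hblind hhom hunit hE₁ hA hΛop hΛhist hρ hs hδ0 hθ0 hθ1 hc hω hω1 hreach hθ'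

end Perturbed

end Summit.QuantumFields.BalabanUV.T4Continuum.ActivityRouteEnd

end
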